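import Summits.ResolutionOfSingularities.ResolutionOfSingularities.Theorems.WildConesCampaignW46AffineFermat
import Summits.ResolutionOfSingularities.ResolutionOfSingularities.Theorems.WildConesCampaignW46ForcedAtomWitnessSurface
import Summits.ResolutionOfSingularities.ResolutionOfSingularities.Theorems.WildConesCampaignW46ForcedAtomExitBoundAll
import HarnessLib

/-!
# [OURS · L1 W4.6, rung (i)/(all n) — brick 26] KERNEL NON-VACUITY WITNESS for the forced-atom regime in EVERY
# dimension: the Fermat atoms `((z^p + Σ_{i<n} u_i^d)·𝒪, p)`, `p < d`, `p ∤ d`, on affine `(n+1)`-space lie in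
# `CampaignW46.Regime.forcedAtom n` — so the all-dimension rungs of bricks 21/22 (p535687, p537008) are not about the
# empty regime when `n ≥ 3`
# (cell res-hironaka, LADDER-RESOLUTION rung L, D-0089; slot W4.6, seat res-L1-s46-pv-2 gen 4; host route `WildCones`,
# crux `ClassicalRegimes` stmt-ResolutionOfSingularities-16884, `--supports … --as helper`)

HONEST FRAMING. Everything here is OURS: an explicit family of STATES `(Z, E)` of the typed procedure (affine
`(n+1)`-space over `K`, the principal hypersurface exponent `((x_n^p + Σ_{i<n} x_i^d)·𝒪, p)`) shown to satisfy res-L1-type-o1's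
regime `Regime.forcedAtom n` (p517839); the typed carriers of row 001 and the regime enter as DEFINITIONS. NOTHING below is
a statement of H. Hironaka's manuscript [Hironaka2017]; no FACT-LIST premise. AI review is weaker than expert review.
Template: this seat's `n = 2` witness p522706 (`…ForcedAtomWitnessSurface`), cited lemma by lemma; the scheme half is
brick 25 (`…AffineFermat`).

## What is proved

* §1 coefficient level (`n` variables, `K` of characteristic `p`, `p ∤ d`): the Fermat sum `−Σ u_i^d` has no `p`-divisible
  monomial (`coeff_negFermatSum_eq_zero`), `𝔪^{n·m+1} ≤ (u_i^m : i)` (`maximalIdeal_pow_le_span_X_pow`), and its state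
  is ISOLATED (`isol_negFermatSum`: the gradient ideal is `(d·u_i^{d−1} : i)`).
* §2 `exists_presentation_origin` — Cohen coordinates `𝒪̂_{𝔸^{n+1},0} ≃+* K⟦z,u⟧` with `x_i ↦ u_i = X (some i)` (`i < n`),
  `x_n ↦ z = X none`.
* §3 `regime_forcedAtom (n) (hpd : p < d) (hd : ¬ p ∣ d)` — **for every PERFECT field `K` of characteristic `p` and every
  `n`, the state `((x_n^p + Σ_{i<n} x_i^d)·𝒪, p)` on `𝔸^{n+1}_K` lies in `Regime.forcedAtom n`** (the ambient datum is
  the affine space of brick 25, built inline); `exists_singular_state_forcedAtom (n)` — the regime contains a STANDARD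
  state with NON-EMPTY singular locus, for EVERY `n`; `finLocalExitBound_forcedAtom_allDim_and_inhabited` — brick 22's
  exit bound on an inhabited regime (`K` algebraically closed, every `n ≥ 1`).

References: p522706 (template), brick 25, p517839 (regime), p537008 (brick 22). [folklore]
-/

noncomputable section

-- single-problem summit: the doubled namespace component `ResolutionOfSingularities` is forced
set_option linter.dupNamespace false

open scoped BigOperators Classical
open MvPowerSeries IsLocalRing
open CategoryTheory AlgebraicGeometry TopologicalSpace

namespace Summit.ResolutionOfSingularities.ResolutionOfSingularities.Theorems

namespace CampaignW46.AffineFermat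

open Literature.AlgebraicGeometry.Resolution Scheme.IdealSheafData
open Literature.AlgebraicGeometry.Hironaka2017.S02Preliminaries
open Literature.AlgebraicGeometry.Hironaka2017.SpecOrders
open Literature.AlgebraicGeometry.Hironaka2017.Datum
open Literature.AlgebraicGeometry.Hironaka2017
open WildCones
open CampaignW46.SurfacePlane (ser_coeff_eq)

variable (p : ℕ) (K : Type) [Field K] (n : ℕ)

/-! ## §1 Coefficient level: the `n`-variable state `−Σ u_i^d` -/

/-- The Fermat sum `−Σ_i u_i^d`, `p ∤ d`, has no monomial with all exponents divisible by `p`. [folklore] -/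
theorem coeff_negFermatSum_eq_zero {d : ℕ} (hd : ¬ p ∣ d) (A : Fin n →₀ ℕ) (hA : ∀ j, p ∣ A j) :
    MvPowerSeries.coeff A (-(∑ i : Fin n, (MvPowerSeries.X i : MvPowerSeries (Fin n) K) ^ d)) = 0 := by
  rw [map_neg, map_sum, Finset.sum_eq_zero, neg_zero]
  intro i _
  rw [coeff_X_pow, if_neg]
  intro h
  exact hd (by simpa [h] using hA i)

/-- In `n` variables, `𝔪^{n·m+1} ≤ (u_0^m, …, u_{n−1}^m)` in `K⟦u⟧` (pigeonhole on exponents). [folklore] -/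
theorem maximalIdeal_pow_le_span_X_pow (m : ℕ) :
    maximalIdeal (MvPowerSeries (Fin n) K) ^ (n * m + 1) ≤
      Ideal.span (Set.range fun i : Fin n => (MvPowerSeries.X i : MvPowerSeries (Fin n) K) ^ m) := by
  rw [Literature.RingTheory.MvPowerSeries.Jets.maximalIdeal_pow_eq_span_monomial, Ideal.span_le]
  rintro _ ⟨e, he, rfl⟩
  -- some exponent `e i ≥ m`
  have : ∃ i, m ≤ e i := by
    by_contra hcon
    push Not at hcon
    have hle : ∑ i, e i ≤ ∑ _i : Fin n, (m - 1) := Finset.sum_le_sum fun i _ => Nat.le_sub_one_of_lt (hcon i)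
    rw [Finset.sum_const, Finset.card_univ, Fintype.card_fin, smul_eq_mul] at hle
    rw [Set.mem_setOf_eq, Finsupp.degree_eq_sum] at he
    have hm : n * (m - 1) ≤ n * m := Nat.mul_le_mul_left n (Nat.sub_le m 1)
    have : ∑ i, e i = n * m + 1 := he
    omega
  obtain ⟨i, hi⟩ := this
  have hsplit : MvPowerSeries.monomial e (1 : K) =
      (MvPowerSeries.X i : MvPowerSeries (Fin n) K) ^ m * MvPowerSeries.monomial (e - Finsupp.single i m) (1 : K) := by
    have hexp : Finsupp.single i m + (e - Finsupp.single i m) = e := by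
      ext j
      rw [Finsupp.add_apply, Finsupp.tsub_apply, Finsupp.single_apply]
      split_ifs with hij
      · subst hij; omega
      · omega
    rw [MvPowerSeries.X_pow_eq, MvPowerSeries.monomial_mul_monomial, one_mul, hexp]
  change MvPowerSeries.monomial e (1 : K) ∈ _
  rw [hsplit]
  exact Ideal.mul_mem_right _ _ (Ideal.subset_span ⟨i, rfl⟩)

/-- The state of `−Σ_i u_i^d` (`p ∤ d`) is ISOLATED: its gradient ideal `(d u_i^{d−1} : i)` contains `𝔪^{n(d−1)+1}`, so
the Milnor algebra is finite over `K`. [folklore] -/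
theorem isol_negFermatSum [CharP K p] {d : ℕ} (hd : ¬ p ∣ d) :
    Isol p n K (fun A : Fin n → ℕ => MvPowerSeries.coeff (Finsupp.equivFunOnFinite.symm A)
      (-(∑ i : Fin n, (MvPowerSeries.X i : MvPowerSeries (Fin n) K) ^ d))) := by
  have hd0 : d ≠ 0 := by
    rintro rfl
    exact hd (dvd_zero p)
  obtain ⟨m, rfl⟩ : ∃ m, d = m + 1 := ⟨d - 1, by omega⟩
  set F : MvPowerSeries (Fin n) K := -(∑ i : Fin n, (MvPowerSeries.X i : MvPowerSeries (Fin n) K) ^ (m + 1)) with hFdef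
  have hser : ser p n K (fun A : Fin n → ℕ => MvPowerSeries.coeff (Finsupp.equivFunOnFinite.symm A) F) = F :=
    ser_coeff_eq p K F (coeff_negFermatSum_eq_zero p K n hd)
  -- the unit `d = m + 1` of `K⟦u⟧`
  have hunit : IsUnit (((m + 1 : ℕ) : MvPowerSeries (Fin n) K)) := by
    rw [← map_natCast (MvPowerSeries.C (σ := Fin n) (R := K))]
    refine IsUnit.map _ (isUnit_iff_ne_zero.mpr fun h => hd ?_)
    exact (CharP.cast_eq_zero_iff K p (m + 1)).mp h
  obtain ⟨u, hu⟩ := hunit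
  -- the partial derivatives
  have hpd : ∀ i : Fin n, WildCones.pd n K i F =
      -(((m + 1 : ℕ) : MvPowerSeries (Fin n) K) * (MvPowerSeries.X i : MvPowerSeries (Fin n) K) ^ m) := by
    intro i
    rw [AtomGerm.pd_eq_pd, hFdef, map_neg, map_sum, Finset.sum_eq_single i]
    · rw [Literature.RingTheory.MvPowerSeries.pd_pow_succ, Literature.RingTheory.MvPowerSeries.pd_X, if_pos rfl, mul_one]
    · intro j _ hj
      rw [Literature.RingTheory.MvPowerSeries.pd_pow_succ, Literature.RingTheory.MvPowerSeries.pd_X, if_neg hj, mul_zero]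
    · intro hi
      exact absurd (Finset.mem_univ i) hi
  -- the gradient ideal contains `(u_i^m : i)`
  have hle : Ideal.span (Set.range fun i : Fin n => (MvPowerSeries.X i : MvPowerSeries (Fin n) K) ^ m) ≤
      jac p n K (fun A : Fin n → ℕ => MvPowerSeries.coeff (Finsupp.equivFunOnFinite.symm A) F) := by
    change _ ≤ Ideal.span (Set.range fun i : Fin n =>
      WildCones.pd n K i (ser p n K (fun A : Fin n → ℕ => MvPowerSeries.coeff (Finsupp.equivFunOnFinite.symm A) F)))
    rw [hser, Ideal.span_le]
    rintro _ ⟨i, rfl⟩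
    have hmem : WildCones.pd n K i F ∈ Ideal.span (Set.range fun i : Fin n => WildCones.pd n K i F) :=
      Ideal.subset_span ⟨i, rfl⟩
    rw [hpd i, ← hu] at hmem
    have h2 := Ideal.mul_mem_left _ (↑u⁻¹ : MvPowerSeries (Fin n) K) ((Ideal.neg_mem_iff _).mp hmem)
    rwa [← mul_assoc, Units.inv_mul, one_mul] at h2
  change Module.Finite K (MvPowerSeries (Fin n) K ⧸
    jac p n K (fun A : Fin n → ℕ => MvPowerSeries.coeff (Finsupp.equivFunOnFinite.symm A) F))
  rw [AtomGerm.finite_quotient_iff_exists_pow_le]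
  exact ⟨n * m + 1, (maximalIdeal_pow_le_span_X_pow K n m).trans hle⟩

/-! ## §2 The origin of affine `(n+1)`-space in Cohen coordinates -/

/-- **Formal coordinates at the origin of `𝔸^{n+1}_K`, with coefficients in `K`**: a ring isomorphism
`𝒪̂_{𝔸^{n+1},0} ≃+* K⟦z,u_0,…,u_{n−1}⟧` with `x_i ↦ u_i = X (some i)` (`i < n`) and `x_n ↦ z = X none` (Cohen's structure
theorem with the prescribed regular system of parameters; the residue field of the `K`-rational origin is `K`).
[cite: Matsumura1987, Thm. 29.7] -/
theorem exists_presentation_origin [Fact p.Prime] [CharP K p] :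
    ∃ E₀ : AdicCompletion (maximalIdeal (St (MvPolynomial (Fin (n + 1)) K) ⟨originIdeal K (n + 1), inferInstance⟩))
        (St (MvPolynomial (Fin (n + 1)) K) ⟨originIdeal K (n + 1), inferInstance⟩) ≃+* MvPowerSeries (Option (Fin n)) K,
      (∀ i : Fin n, E₀ (algebraMap _ _ (algebraMap (MvPolynomial (Fin (n + 1)) K)
          (St (MvPolynomial (Fin (n + 1)) K) ⟨originIdeal K (n + 1), inferInstance⟩) (MvPolynomial.X (Fin.castSucc i)))) =
        MvPowerSeries.X (some i)) ∧
      E₀ (algebraMap _ _ (algebraMap (MvPolynomial (Fin (n + 1)) K)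
          (St (MvPolynomial (Fin (n + 1)) K) ⟨originIdeal K (n + 1), inferInstance⟩) (MvPolynomial.X (Fin.last n)))) =
        MvPowerSeries.X none := by
  set x₀ : Zs (MvPolynomial (Fin (n + 1)) K) := ⟨originIdeal K (n + 1), inferInstance⟩ with hx₀
  have hx : x₀.asIdeal = originIdeal K (n + 1) := rfl
  haveI hreg : IsRegularLocalRing (St (MvPolynomial (Fin (n + 1)) K) x₀) := isRegularLocalRing_stalk p K n x₀
  -- the affine space as an ambient datum (brick 25's smoothness), and a field inside the stalk
  let A : AmbientDatum p K :=
    { Z := Zs (MvPolynomial (Fin (n + 1)) K)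
      hom := Spec.map (CommRingCat.ofHom (algebraMap K (MvPolynomial (Fin (n + 1)) K)))
      irreducible := inferInstanceAs (IrreducibleSpace (PrimeSpectrum (MvPolynomial (Fin (n + 1)) K)))
      smooth := smooth_spec K n
      quasiCompact := inferInstance }
  obtain ⟨k₀, hk₀⟩ := AmbientDatum.exists_isField_subring_stalk A x₀
  -- the residue field of the origin is `K`
  haveI : IsLocalization.AtPrime (St (MvPolynomial (Fin (n + 1)) K) x₀) (originIdeal K (n + 1)) :=
    isLocSt (MvPolynomial (Fin (n + 1)) K) x₀
  let ι : ResidueField (St (MvPolynomial (Fin (n + 1)) K) x₀) ≃+* K :=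
    (IsLocalization.AtPrime.equivQuotMaximalIdeal (originIdeal K (n + 1)) (St (MvPolynomial (Fin (n + 1)) K) x₀)).symm.trans
      (RingHom.quotientKerEquivOfSurjective (Literature.AlgebraicGeometry.Resolution.constantCoeff_surjective K (n + 1)))
  -- the regular system of parameters `(x_i/1)`
  let z : Fin (n + 1) → St (MvPolynomial (Fin (n + 1)) K) x₀ := fun i =>
    algebraMap (MvPolynomial (Fin (n + 1)) K) (St (MvPolynomial (Fin (n + 1)) K) x₀) (MvPolynomial.X i)
  have hz : Ideal.span (Set.range z) = maximalIdeal (St (MvPolynomial (Fin (n + 1)) K) x₀) := by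
    rw [show maximalIdeal (St (MvPolynomial (Fin (n + 1)) K) x₀) =
      maximalIdeal ((Zs (MvPolynomial (Fin (n + 1)) K)).presheaf.stalk x₀) from rfl, maximalIdeal_stalk_origin K n hx]
  have hd : ringKrullDim (St (MvPolynomial (Fin (n + 1)) K) x₀) = ((n + 1 : ℕ) : WithBot ℕ∞) :=
    ringKrullDim_stalk_origin K n hx
  obtain ⟨e, he⟩ := @exists_ringEquiv_adicCompletion_mvPowerSeries_of_rsop (St (MvPolynomial (Fin (n + 1)) K) x₀) _ hreg
    k₀ hk₀ K _ ι (n + 1) z hz hd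
  refine ⟨e.trans (renameEquiv K (finSuccEquivLast (n := n))).toRingEquiv, fun i => ?_, ?_⟩
  · rw [RingEquiv.trans_apply, he (Fin.castSucc i)]
    exact (rename_X (⇑(finSuccEquivLast (n := n))) (Fin.castSucc i) :
      rename (⇑(finSuccEquivLast (n := n))) (MvPowerSeries.X (Fin.castSucc i) : MvPowerSeries (Fin (n + 1)) K) = _).trans
        (by rw [finSuccEquivLast_castSucc])
  · rw [RingEquiv.trans_apply, he (Fin.last n)]
    exact (rename_X (⇑(finSuccEquivLast (n := n))) (Fin.last n) :
      rename (⇑(finSuccEquivLast (n := n))) (MvPowerSeries.X (Fin.last n) : MvPowerSeries (Fin (n + 1)) K) = _).trans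
        (by rw [finSuccEquivLast_last])

/-! ## §3 The Fermat atoms lie in the forced-atom regime, in every dimension -/

/-- [OURS · L1 W4.6 rung (i)/(all n) — NON-VACUITY WITNESS in EVERY dimension; NOT a statement of the manuscript]
**The standard state `((x_n^p + Σ_{i<n} x_i^d)·𝒪, p)` on `𝔸^{n+1}_K` lies in `Regime.forcedAtom n`** for every perfect
field `K` of characteristic `p`, every `n` and every `d` with `p < d`, `p ∤ d` (the ambient datum: affine `(n+1)`-space
over `K`, smooth and irreducible, brick 25): its singular locus is the origin, of embedding dimension `n + 1`, where
`J_0` is carried by the Cohen coordinates to the atom `z^p − (−Σ u_i^d)` of the ISOLATED `n`-variable Fermat state of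
route `WildCones`' calculus. [folklore] -/
theorem regime_forcedAtom [Fact p.Prime] [CharP K p] [PerfectRing K p] {d : ℕ} (hpd : p < d) (hd : ¬ p ∣ d) :
    Regime.forcedAtom (p := p) (K := K) n
      ({ Z := Zs (MvPolynomial (Fin (n + 1)) K)
         hom := Spec.map (CommRingCat.ofHom (algebraMap K (MvPolynomial (Fin (n + 1)) K)))
         irreducible := inferInstanceAs (IrreducibleSpace (PrimeSpectrum (MvPolynomial (Fin (n + 1)) K)))
         smooth := smooth_spec K n
         quasiCompact := inferInstance } : AmbientDatum p K)
      ⟨shf (MvPolynomial (Fin (n + 1)) K)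
        (Ideal.span {MvPolynomial.X (Fin.last n) ^ p + ∑ j : Fin n, MvPolynomial.X (Fin.castSucc j) ^ d}), p⟩ := by
  refine Regime.forcedAtom_of_exists _ _ ⟨rfl, sing_subsingleton p K n hpd hd, fun ξ hξ => ?_⟩
  have hx : ξ.asIdeal = originIdeal K (n + 1) := (mem_sing_iff p K n hpd hd ξ).mp hξ
  obtain rfl : ξ = ⟨originIdeal K (n + 1), inferInstance⟩ := PrimeSpectrum.ext hx
  have hpres : ∃ (E₀ : AdicCompletion (maximalIdeal (St (MvPolynomial (Fin (n + 1)) K) ⟨originIdeal K (n + 1), inferInstance⟩))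
        (St (MvPolynomial (Fin (n + 1)) K) ⟨originIdeal K (n + 1), inferInstance⟩) ≃+* MvPowerSeries (Option (Fin n)) K)
      (f₀ : St (MvPolynomial (Fin (n + 1)) K) ⟨originIdeal K (n + 1), inferInstance⟩) (c₀ : (Fin n → ℕ) → K)
      (w₀ : MvPowerSeries (Option (Fin n)) K),
      stalkIdeal (shf (MvPolynomial (Fin (n + 1)) K)
          (Ideal.span {MvPolynomial.X (Fin.last n) ^ p + ∑ j : Fin n, MvPolynomial.X (Fin.castSucc j) ^ d}))
          ⟨originIdeal K (n + 1), inferInstance⟩ = Ideal.span {f₀} ∧ IsUnit w₀ ∧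
        E₀ (algebraMap _ _ f₀) = w₀ * ((MvPowerSeries.X none : MvPowerSeries (Option (Fin n)) K) ^ p -
          rename (some : Fin n → Option (Fin n)) (ser p n K c₀)) ∧ Isol p n K c₀ := by
    obtain ⟨E₀, h0, h1⟩ := exists_presentation_origin p K n
    refine ⟨E₀, _, _, 1, stalkIdeal_eq_span p K n d _, isUnit_one, ?_, isol_negFermatSum p K n hd⟩
    rw [ser_coeff_eq p K _ (coeff_negFermatSum_eq_zero p K n hd)]
    simp only [map_add, map_pow, map_sum, h0, h1, map_neg, rename_X, one_mul, sub_neg_eq_add]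
  have hdim : (maximalIdeal (St (MvPolynomial (Fin (n + 1)) K) ⟨originIdeal K (n + 1), inferInstance⟩)).spanFinrank = n + 1 :=
    spanFinrank_maximalIdeal_stalk_origin p K n rfl
  exact ⟨hdim, hpres⟩

/-- [OURS · L1 W4.6 rung (i)/(all n) — NON-VACUITY in EVERY dimension; NOT a statement of the manuscript] For every
prime `p`, every PERFECT field `K` of characteristic `p` and EVERY `n`, the forced-atom regime `Regime.forcedAtom n` of the
typed Th. 16.6 procedure contains a STANDARD state with NON-EMPTY singular locus (the Fermat atom
`((x_n^p + Σ_{i<n} x_i^{p+1})·𝒪, p)` on `𝔸^{n+1}_K`). [folklore] -/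
theorem exists_singular_state_forcedAtom [Fact p.Prime] [CharP K p] [PerfectRing K p] :
    ∃ (A : AmbientDatum p K) (E : IdealExponent A.Z),
      Regime.forcedAtom (p := p) (K := K) n A E ∧ E.IsStandard ∧ E.sing.Nonempty := by
  have hp : p.Prime := Fact.out
  have hn : ¬ p ∣ p + 1 := fun h => hp.one_lt.ne' (Nat.dvd_one.mp ((Nat.dvd_add_right (dvd_refl p)).mp h))
  exact ⟨_, _, regime_forcedAtom p K n (Nat.lt_succ_self p) hn, isStandard p K n (Nat.lt_succ_self p),
    sing_nonempty p K n (Nat.lt_succ_self p) hn⟩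

/-- [OURS · L1 W4.6 rung (i)/(all n); NOT a statement of the manuscript] **The all-dimension rung on an inhabited regime.**
Over an algebraically closed field `K` of characteristic `p`, for EVERY `n ≥ 1`: brick 22's exit bound
`FinLocalExitBound (Regime.forcedAtom n)` HOLDS (bound `μ + 1`) AND the regime contains a standard state with non-empty
singular locus — the number is not about the empty regime. [folklore] -/
theorem finLocalExitBound_forcedAtom_allDim_and_inhabited [Fact p.Prime] [CharP K p] [IsAlgClosed K] (hn : 0 < n) :
    FinLocalExitBound (Regime.forcedAtom (p := p) (K := K) n) ∧
      ∃ (A : AmbientDatum p K) (E : IdealExponent A.Z),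
        Regime.forcedAtom (p := p) (K := K) n A E ∧ E.IsStandard ∧ E.sing.Nonempty := by
  haveI : PerfectRing K p := PerfectField.toPerfectRing p
  exact ⟨ForcedAtom.finLocalExitBound_forcedAtom_allDim hn, exists_singular_state_forcedAtom p K n⟩

end CampaignW46.AffineFermat

end Summit.ResolutionOfSingularities.ResolutionOfSingularities.Theorems

end
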